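import Summits.QuantumFields.QCD.Theses.WilsonMobilityGap
import Literature.MathematicalPhysics.QuantumLattice.WilsonPositivityDomain
import Literature.MathematicalPhysics.QuantumLattice.GrassmannIntegralWilsonProofs

/-!
# Sketch — crux-ideate round 1, ideator 2, crux `ChiralMobilityGap` (stmt-QuantumFields-17497)

First lemmas for two crux idea cards (planner-cruxidea-stmt-QuantumFields-17497-2-0):

* §1 `vacuum-sector-pin`: the pin `reg.IsChiralAtZero` re-read (negation of `HasLatticeMassGap`
  pushed through the filter: ONE pair, ONE volume, ONE time per `k`, frequently in `k`), the
  log-convexity toolkit (ratio monotonicity, geometric lower bound, "one effective-mass dip beats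
  every faster rate"), the typed supertrace-reduction hypothesis `StrReduced` and the transfer
  statement `DipAlong → IsChiralAtZero` (`isChiralAtZero_of_dip`, proved from `StrReduced`-data
  modulo the two analysis lemmas, which are proved).
* §2 `flavoured-theta-pi-index`: the `U(1)_u`-twisted one-flavour weight over `U(3)`-valued links,
  its reality and its positivity at positive bare mass (both PROVED from tree facts), and the typed
  programme statements `TwistSignFlipsDeep`, `TwistSignRigidOnGapped`, `NonGappedBelow`.
-/

noncomputable section

open scoped BigOperators Topology
open MeasureTheory Filter Set
open Literature.MathematicalPhysics.QuantumFieldTheory Literature.MathematicalPhysics.QuantumLattice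
  Literature.Probability.LatticeModels

namespace Summit.QuantumFields.QCD.Cruxes.ChiralMobilityGap.Ideator2

local notation "SU3" => Matrix.specialUnitaryGroup (Fin 3) ℂ
local notation "U3" => Matrix.unitaryGroup (Fin 3) ℂ

variable {Nf : ℕ}

/-! ## §1 The pin lives in the vacuum sector -/

/-- **The pin, re-read.** `¬ HasLatticeMassGap ε` along a scheme is witnessed by ONE observable
pair and, for every constant `C`, FREQUENTLY in `k` by ONE volume `S ≥ L_k` and ONE time `n ≤ S`
at which the connected correlator beats `C e^{-ε a_k n}` (pure logic: negations pushed through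
`∀`, `∃`, `∀ᶠ`). This is the quantifier shape every argument of card `vacuum-sector-pin` uses:
`t` fixed first, then a subsequence of `k`, with `S` FREE (sent to `∞` at fixed `k`). -/
theorem not_hasLatticeMassGap_iff (sch : QCDScheme Nf) (ε : ℝ) :
    ¬ sch.HasLatticeMassGap ε ↔
      ∃ (R R' : ℕ) (A : QCDLatticeObservable Nf R) (B : QCDLatticeObservable Nf R'),
        ∀ C : ℝ, ∃ᶠ k in atTop, ∃ S : ℕ, sch.L k ≤ S ∧ ∃ n : ℕ, n ≤ S ∧
          C * Real.exp (-(ε * (sch.a k * n))) <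
            ‖qcdLatticeConnectedCorr (sch.β k) (2 * S + 1) (fun fl => sch.mq fl k) A B n‖ := by
  simp only [QCDScheme.HasLatticeMassGap, not_forall, not_exists, Filter.not_eventually, not_le]
  constructor
  · rintro ⟨R, R', A, B, h⟩
    refine ⟨R, R', A, B, fun C => (h C).mono fun k hk => ?_⟩
    obtain ⟨S, hS, n, hn, hlt⟩ := hk
    exact ⟨S, hS, n, hn, hlt⟩
  · rintro ⟨R, R', A, B, h⟩
    refine ⟨R, R', A, B, fun C => (h C).mono fun k hk => ?_⟩
    obtain ⟨S, hS, n, hn, hlt⟩ := hk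
    exact ⟨S, hS, n, hn, hlt⟩

/-- **Ratio monotonicity of a positive log-convex sequence** (the effective mass is
non-increasing): `c(m+1)/c(m) ≤ c(n+1)/c(n)` for `m ≤ n`. For the vacuum two-point function of a
positive transfer matrix, `c n = Σ_i w_i λ_i^n` (`w_i ≥ 0`, `0 ≤ λ_i ≤ 1`) is log-convex by
Cauchy–Schwarz (Montvay–Münster §7.1; tree `TorusTransferSpectral`, `TwoPointLogConvex` for spin
models). [folklore] -/
theorem ratio_mono_of_logConvex (c : ℕ → ℝ) (hpos : ∀ n, 0 < c n)
    (hconv : ∀ n, c (n + 1) ^ 2 ≤ c n * c (n + 2)) {m n : ℕ} (hmn : m ≤ n) :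
    c (m + 1) / c m ≤ c (n + 1) / c n := by
  induction n, hmn using Nat.le_induction with
  | base => exact le_rfl
  | succ n _ ih =>
    refine ih.trans ?_
    rw [div_le_div_iff₀ (hpos n) (hpos (n + 1))]
    nlinarith [hconv n, hpos n, hpos (n + 1), hpos (n + 2)]

/-- **Geometric lower bound from one ratio.** If the ratio at time `n₁` is at least `q > 0`, then
`c n ≥ c n₁ · q^{n - n₁}` for all `n ≥ n₁`: the decay per step beyond `n₁` is never worse than at
`n₁` (chord transfer from a single step; the card's "one dip is enough"). [folklore] -/
theorem geom_lower_of_logConvex (c : ℕ → ℝ) (hpos : ∀ n, 0 < c n)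
    (hconv : ∀ n, c (n + 1) ^ 2 ≤ c n * c (n + 2)) {q : ℝ} (hq : 0 < q) {n₁ : ℕ}
    (hratio : q ≤ c (n₁ + 1) / c n₁) {n : ℕ} (hn : n₁ ≤ n) :
    c n₁ * q ^ (n - n₁) ≤ c n := by
  induction n, hn using Nat.le_induction with
  | base => simp
  | succ n hle ih =>
    have hr : q ≤ c (n + 1) / c n := hratio.trans (ratio_mono_of_logConvex c hpos hconv hle)
    have hstep : c n * q ≤ c (n + 1) := by
      rw [le_div_iff₀ (hpos n)] at hr; linarith [hr]
    calc c n₁ * q ^ (n + 1 - n₁) = (c n₁ * q ^ (n - n₁)) * q := by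
          rw [Nat.sub_add_comm hle, pow_succ, mul_assoc]
      _ ≤ c n * q := by exact mul_le_mul_of_nonneg_right ih hq.le
      _ ≤ c (n + 1) := hstep

/-- **One effective-mass dip beats every faster rate.** If a positive log-convex sequence has ONE
ratio `c(n₁+1)/c(n₁) ≥ e^{-r}` and `r < r'`, then for every constant `C` it exceeds `C e^{-r' n}`
at all large `n` — with NO lower bound on the amplitude `c n₁ > 0` needed (this is why the free
`∃ S, ∃ n ≤ S` of the pin makes the amplitude problem disappear). [folklore] -/
theorem eventually_exceeds_of_dip (c : ℕ → ℝ) (hpos : ∀ n, 0 < c n)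
    (hconv : ∀ n, c (n + 1) ^ 2 ≤ c n * c (n + 2)) {r r' : ℝ} (hrr : r < r') {n₁ : ℕ}
    (hdip : Real.exp (-r) ≤ c (n₁ + 1) / c n₁) (C : ℝ) :
    ∀ᶠ n : ℕ in atTop, C * Real.exp (-(r' * (n : ℝ))) < c n := by
  -- `c n ≥ c n₁ e^{-r (n - n₁)} = (c n₁ e^{r n₁}) e^{-r n}` and `C e^{-r' n} / e^{-r n} → 0`.
  have hq : 0 < Real.exp (-r) := Real.exp_pos _
  have hlow : ∀ n, n₁ ≤ n → c n₁ * Real.exp (-r) ^ (n - n₁) ≤ c n :=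
    fun n hn => geom_lower_of_logConvex c hpos hconv hq hdip hn
  have hK : 0 < c n₁ * Real.exp (r * n₁) := mul_pos (hpos n₁) (Real.exp_pos _)
  -- the ratio `C e^{-(r'-r) n} / (c n₁ e^{r n₁ ⋯})` tends to `0`
  have hlim : Tendsto (fun n : ℕ => C * Real.exp (-((r' - r) * n))) atTop (𝓝 0) := by
    have h1 : Tendsto (fun n : ℕ => (r' - r) * (n : ℝ)) atTop atTop :=
      Tendsto.const_mul_atTop (by linarith) tendsto_natCast_atTop_atTop
    have h2 : Tendsto (fun n : ℕ => Real.exp (-((r' - r) * n))) atTop (𝓝 0) :=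
      Real.tendsto_exp_neg_atTop_nhds_zero.comp h1
    simpa using h2.const_mul C
  have hev := (hlim.eventually (gt_mem_nhds hK)).and (eventually_ge_atTop n₁)
  filter_upwards [hev] with n ⟨hn, hn₁⟩
  have hle := hlow n hn₁
  -- rewrite `e^{-r}^(n-n₁)` as `e^{-r n} e^{r n₁}`
  have hpow : Real.exp (-r) ^ (n - n₁) = Real.exp (-(r * n)) * Real.exp (r * n₁) := by
    rw [← Real.exp_nat_mul, ← Real.exp_add]
    congr 1
    rw [Nat.cast_sub hn₁]
    ring
  rw [hpow] at hle
  have hexp : Real.exp (-(r' * n)) = Real.exp (-((r' - r) * n)) * Real.exp (-(r * n)) := by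
    rw [← Real.exp_add]; congr 1; ring
  calc C * Real.exp (-(r' * n))
      = (C * Real.exp (-((r' - r) * n))) * Real.exp (-(r * n)) := by rw [hexp, mul_assoc]
    _ < (c n₁ * Real.exp (r * n₁)) * Real.exp (-(r * n)) :=
        mul_lt_mul_of_pos_right hn (Real.exp_pos _)
    _ = c n₁ * (Real.exp (-(r * n)) * Real.exp (r * n₁)) := by ring
    _ ≤ c n := hle

/-- The honest (signed, time-periodic, odd-torus) connected correlator of the tree along the
degenerate trajectory of renormalised mass `t` of `reg`: step `k`, torus side `2S+1`, time `n`. -/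
def corrAlong (reg : QCDRegularisation Nf) (t : ℝ) {R R' : ℕ} (A : QCDLatticeObservable Nf R)
    (B : QCDLatticeObservable Nf R') (k S n : ℕ) : ℂ :=
  qcdLatticeConnectedCorr (reg.β k) (2 * S + 1)
    (fun _ : Fin Nf => reg.mcrit k + reg.a k * t / reg.Zm k) A B n

/-- **Supertrace reduction at step `k` (typed hypothesis, the output of the card's soft lemmas
S1–S3).** As the torus grows at FIXED cutoff `k`, the `(−1)^F`-twisted periodic functional of the
pair `(A, B)` converges, time by time, to a POSITIVE LOG-CONVEX sequence `c` — the vacuum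
two-point function `⟨Ω, Â† T̄ⁿ B̂ Ω⟩` of Lüscher's positive transfer matrix (for `B = A†`-type
pairs), reached because `S → ∞` sends both the time extent and the spatial side to infinity and
the `(−1)^F`/thermal corrections are `O(V₃ e^{-g_k (2S+1)}) → 0` whenever the theory at
`(β_k, m(k))` has ANY spectral gap `g_k > 0`. Inputs: the landed periodic supertrace forms
(`integral_fermiBoltzmann_wilsonMeasure_eq_cyclic_supertrace`,
`det_diracMatrix_eq_supertrace_fermionSliceOp`), Lüscher positivity for bare masses `> −1`. -/
def StrReduced (reg : QCDRegularisation Nf) (t : ℝ) {R R' : ℕ} (A : QCDLatticeObservable Nf R)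
    (B : QCDLatticeObservable Nf R') (k : ℕ) (c : ℕ → ℝ) : Prop :=
  (∀ n, 0 < c n) ∧ (∀ n, c (n + 1) ^ 2 ≤ c n * c (n + 2)) ∧
    ∀ n, Tendsto (fun S : ℕ => ‖corrAlong reg t A B k S n‖) atTop (𝓝 (c n))

/-- **`DipAlong` — the transferred form C⁺ of the pin for ONE pair and ONE rate.** Frequently in
`k`, the step-`k` theory along the degenerate trajectory of mass `t` is supertrace-reduced to a
vacuum correlator `c` having ONE effective-mass dip below the physical rate `ε`:
`c(n₁+1)/c(n₁) ≥ e^{-ε a_k}` at some time `n₁`. An UPPER bound on ONE effective mass at ONE time,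
no amplitude, no volume uniformity, no sign bookkeeping. -/
def DipAlong (reg : QCDRegularisation Nf) {R R' : ℕ} (A : QCDLatticeObservable Nf R)
    (B : QCDLatticeObservable Nf R') (ε t : ℝ) : Prop :=
  ∃ᶠ k in atTop, ∃ c : ℕ → ℝ, StrReduced reg t A B k c ∧
    ∃ n₁ : ℕ, Real.exp (-(ε * reg.a k)) ≤ c (n₁ + 1) / c n₁

/-- **Transfer: effective-mass dips along light degenerate trajectories give the pin.** If for
every rate `ε > 0` some positive renormalised mass `t` and some observable pair dip below a
STRICTLY smaller rate `ε' < ε` frequently in `k`, then `reg.IsChiralAtZero`. Proof: at such a `k`,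
`eventually_exceeds_of_dip` (with `r = ε' a_k < r' = ε a_k`) makes the vacuum correlator beat
`2C e^{-ε a_k n}` at all large `n`; pick `n ≥ L_k`, then `S ≥ n` so large that the torus
functional is within a factor `2` of `c n` (`StrReduced`), and read off `not_hasLatticeMassGap_iff`
with the degenerate tuple `m = t·1`. -/
theorem isChiralAtZero_of_dip (reg : QCDRegularisation Nf)
    (h : ∀ ε > (0 : ℝ), ∃ t > (0 : ℝ), ∃ ε' : ℝ, 0 < ε' ∧ ε' < ε ∧
      ∃ (R R' : ℕ) (A : QCDLatticeObservable Nf R) (B : QCDLatticeObservable Nf R'),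
        DipAlong reg A B ε' t) :
    reg.IsChiralAtZero := by
  intro ε hε
  obtain ⟨t, ht, ε', hε', hε'ε, R, R', A, B, hdip⟩ := h ε hε
  refine ⟨fun _ => t, fun _ => ht, ?_⟩
  rw [not_hasLatticeMassGap_iff]
  refine ⟨R, R', A, B, fun C => ?_⟩
  refine hdip.mono fun k hk => ?_
  obtain ⟨c, ⟨hpos, hconv, hlim⟩, n₁, hratio⟩ := hk
  have hak : 0 < reg.a k := reg.a_pos k
  -- the vacuum correlator beats `(|C|+1)·2 · e^{-ε a_k n}` for all large `n`
  have hev := eventually_exceeds_of_dip c hpos hconv (r := ε' * reg.a k) (r' := ε * reg.a k)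
    (mul_lt_mul_of_pos_right hε'ε hak) hratio (2 * (|C| + 1))
  obtain ⟨n, hn, hLn⟩ := (hev.and (eventually_ge_atTop (reg.L k))).exists
  -- at this `n`, take `S ≥ n` with the torus functional within a factor 2 of `c n`
  have hcn : 0 < c n := hpos n
  have hS := ((hlim n).eventually (lt_mem_nhds (show c n / 2 < c n by linarith))).and
    (eventually_ge_atTop n)
  obtain ⟨S, hSgt, hSn⟩ := hS.exists
  refine ⟨S, hLn.trans hSn, n, hSn, ?_⟩
  have hCle : C * Real.exp (-(ε * (reg.a k * n))) ≤ (|C| + 1) * Real.exp (-(ε * (reg.a k * n))) :=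
    mul_le_mul_of_nonneg_right (by linarith [le_abs_self C]) (Real.exp_pos _).le
  have h2 : 2 * (|C| + 1) * Real.exp (-(ε * reg.a k * n)) < c n := by simpa [mul_assoc] using hn
  have hpos' : 0 ≤ (|C| + 1) * Real.exp (-(ε * (reg.a k * n))) := by positivity
  calc C * Real.exp (-(ε * (reg.a k * n)))
      ≤ (|C| + 1) * Real.exp (-(ε * (reg.a k * n))) := hCle
    _ < c n / 2 := by
        have : (|C| + 1) * Real.exp (-(ε * (reg.a k * n))) * 2 < c n := by
          calc (|C| + 1) * Real.exp (-(ε * (reg.a k * n))) * 2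
              = 2 * (|C| + 1) * Real.exp (-(ε * reg.a k * n)) := by ring_nf
            _ < c n := h2
        linarith
    _ < ‖corrAlong reg t A B k S n‖ := hSgt

/-! ## §2 The flavoured `θ = π` index -/

/-- The `U(1)_u`-TWISTED one-flavour Wilson weight: flavour `u` propagates in `U(3)`-valued links
`V` (the `SU(3)` field multiplied by a classical `U(1)` background `e^{ia_e}` coupling to the
EXACT single-flavour number symmetry `U(1)_u`), the other `N_f - 1` flavours in the `SU(3)` field
`U`; all at the flavour-symmetric bare mass `x`, `r = 1`. (`V` is kept abstract: any `U(3)`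
field; the card instantiates `V = U · e^{ia}` with `a` of second Chern class one on the torus.) -/
def twistedWeight {L : ℕ} [NeZero L] (Nf : ℕ) (V : GaugeConfig 4 L U3) (U : GaugeConfig 4 L SU3)
    (x : ℝ) : ℂ :=
  fermionDet (wilsonDirac (unitaryFundamentalRep (Fin 3) ℂ) V x 1) *
    fermionDet (wilsonDirac (fundamentalRep (Fin 3)) U x 1) ^ (Nf - 1)

/-- **The twisted weight is REAL** for every `U(3)` twist and every bare mass (γ₅-hermiticity,
tree fact `fermionDet_wilsonDirac_im_holds`, flavour by flavour): so its gauge average — the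
twisted partition function — is real, and under CP (which is exact for the Wilson action and maps
the background to its conjugate class) its SIGN is the only invariant datum: the flavoured axion
angle `θ_u ∈ {0, π}`. -/
theorem twistedWeight_im {L : ℕ} [NeZero L] (Nf : ℕ) (V : GaugeConfig 4 L U3)
    (U : GaugeConfig 4 L SU3) (x : ℝ) : (twistedWeight Nf V U x).im = 0 := by
  have hV : (fermionDet (wilsonDirac (unitaryFundamentalRep (Fin 3) ℂ) V x 1)).im = 0 :=
    fermionDet_wilsonDirac_im_holds (ρ := unitaryFundamentalRep (Fin 3) ℂ) (fun g => g.2) V x 1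
  have hU : (fermionDet (wilsonDirac (fundamentalRep (Fin 3)) U x 1)).im = 0 :=
    fermionDet_wilsonDirac_im_holds (ρ := fundamentalRep (Fin 3)) (fun g => g.2.1) U x 1
  obtain ⟨ra, hra⟩ : ∃ r : ℝ, (r : ℂ) = fermionDet (wilsonDirac (unitaryFundamentalRep (Fin 3) ℂ) V x 1) :=
    ⟨(fermionDet (wilsonDirac (unitaryFundamentalRep (Fin 3) ℂ) V x 1)).re, Complex.ext (by simp) (by simp [hV])⟩
  obtain ⟨rb, hrb⟩ : ∃ r : ℝ, (r : ℂ) = fermionDet (wilsonDirac (fundamentalRep (Fin 3)) U x 1) :=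
    ⟨(fermionDet (wilsonDirac (fundamentalRep (Fin 3)) U x 1)).re, Complex.ext (by simp) (by simp [hU])⟩
  rw [twistedWeight, ← hra, ← hrb, ← Complex.ofReal_pow, ← Complex.ofReal_mul, Complex.ofReal_im]

/-- **End value on the heavy side: `θ_u = 0`.** At POSITIVE bare mass the twisted weight is
STRICTLY POSITIVE for every twist and every field (Seiler's positivity domain `κ < 1/8`, tree
`fermionDet_wilsonDirac_re_pos`, which holds for any unitary representation — the `U(1)` phases
keep the links unitary): the twisted partition function is positive, configuration by
configuration, with no gauge average needed. -/
theorem twistedWeight_re_pos {L : ℕ} [NeZero L] (Nf : ℕ) (V : GaugeConfig 4 L U3)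
    (U : GaugeConfig 4 L SU3) {x : ℝ} (hx : 0 < x) : 0 < (twistedWeight Nf V U x).re := by
  have hV := fermionDet_wilsonDirac_re_pos (ρ := unitaryFundamentalRep (Fin 3) ℂ) (fun g => g.2) V hx
  have hU := fermionDet_wilsonDirac_re_pos (ρ := fundamentalRep (Fin 3)) (fun g => g.2.1) U hx
  have hVi : (fermionDet (wilsonDirac (unitaryFundamentalRep (Fin 3) ℂ) V x 1)).im = 0 :=
    fermionDet_wilsonDirac_im_holds (ρ := unitaryFundamentalRep (Fin 3) ℂ) (fun g => g.2) V x 1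
  have hUi : (fermionDet (wilsonDirac (fundamentalRep (Fin 3)) U x 1)).im = 0 :=
    fermionDet_wilsonDirac_im_holds (ρ := fundamentalRep (Fin 3)) (fun g => g.2.1) U x 1
  obtain ⟨ra, hra⟩ : ∃ r : ℝ, (r : ℂ) = fermionDet (wilsonDirac (unitaryFundamentalRep (Fin 3) ℂ) V x 1) :=
    ⟨(fermionDet (wilsonDirac (unitaryFundamentalRep (Fin 3) ℂ) V x 1)).re, Complex.ext (by simp) (by simp [hVi])⟩
  obtain ⟨rb, hrb⟩ : ∃ r : ℝ, (r : ℂ) = fermionDet (wilsonDirac (fundamentalRep (Fin 3)) U x 1) :=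
    ⟨(fermionDet (wilsonDirac (fundamentalRep (Fin 3)) U x 1)).re, Complex.ext (by simp) (by simp [hUi])⟩
  have hra' : 0 < ra := by rw [← hra] at hV; simpa using hV
  have hrb' : 0 < rb := by rw [← hrb] at hU; simpa using hU
  rw [twistedWeight, ← hra, ← hrb, ← Complex.ofReal_pow, ← Complex.ofReal_mul, Complex.ofReal_re]
  exact mul_pos hra' (pow_pos hrb' _)

/-- A link of `SU(3)` multiplied by the `U(1)` phase `e^{iθ}` is a `U(3)` link. [folklore] -/
def twistLink (θ : ℝ) (g : SU3) : U3 :=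
  ⟨Complex.exp (θ * Complex.I) • ((g : SU3) : Matrix (Fin 3) (Fin 3) ℂ), by
    rw [Matrix.mem_unitaryGroup_iff]
    have hu : ((g : SU3) : Matrix (Fin 3) (Fin 3) ℂ) * star ((g : SU3) : Matrix (Fin 3) (Fin 3) ℂ) = 1 :=
      Matrix.mem_unitaryGroup_iff.1 g.2.1
    have hc : Complex.exp (θ * Complex.I) * star (Complex.exp (θ * Complex.I)) = 1 := by
      rw [Complex.star_def, Complex.mul_conj, Complex.normSq_eq_norm_sq, Complex.norm_exp_ofReal_mul_I]
      simp
    rw [Matrix.star_eq_conjTranspose, Matrix.conjTranspose_smul, Matrix.smul_mul,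
      Matrix.mul_smul, smul_smul, ← Matrix.star_eq_conjTranspose, hu, hc, one_smul]⟩

/-- The `U(1)_u`-twisted partition function of `N_f`-flavour Wilson lattice QCD at inverse coupling
`β`, flavour-symmetric bare mass `x`, torus side `2S+1`, for a background phase field
`a : Edge → ℝ` (links of flavour `u` multiplied by `e^{i a_e}`). -/
def twistedZ (Nf : ℕ) (β x : ℝ) (S : ℕ) (a : Edge 4 (2 * S + 1) → ℝ) : ℝ :=
  (∫ U : GaugeConfig 4 (2 * S + 1) SU3,
      twistedWeight Nf (fun e => twistLink (a e) (U e)) U x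
        ∂(wilsonMeasure (fundamentalRep (Fin 3)) β)).re

/-- **Uniform lattice gap at ONE cutoff** (the single-`k` shadow of `HasLatticeMassGap`, lattice
units): at `(β, x)` every pair of gauge-invariant local observables clusters at rate `g` on all
tori of side `≥ 2L+1`, uniformly. -/
def GappedAt (Nf : ℕ) (β x g : ℝ) (L : ℕ) : Prop :=
  0 < g ∧ ∀ (R R' : ℕ) (A : QCDLatticeObservable Nf R) (B : QCDLatticeObservable Nf R'), ∃ C : ℝ,
    ∀ S : ℕ, L ≤ S → ∀ n : ℕ, n ≤ S →
      ‖qcdLatticeConnectedCorr β (2 * S + 1) (fun _ : Fin Nf => x) A B n‖ ≤ C * Real.exp (-(g * n))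

/-- **Programme statement T1 (rigidity of the twist sign on gapped CP-symmetric families; the
Euclidean four-dimensional analogue of Hastings–Michalakis / Bachmann–Bols–De Roeck–Fraas index
constancy).** Along a bare-mass interval on which the theory is uniformly gapped with ONE rate and
ONE volume floor, the sign of the large-volume twisted partition function for a background of unit
`U(1)_u` instanton number is constant (it can only flip where the gap closes or CP breaks). Typed
here in the weakest usable form: gapped on `[x₁, x₂]` ⇒ eventually-in-`S` sign agreement at the
two ends, for every admissible unit-charge background family `a_S`. UNPROVED; the card's debt. -/
def TwistSignRigidOnGapped (Nf : ℕ) (β : ℝ) (L : ℕ)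
    (a : ∀ S : ℕ, Edge 4 (2 * S + 1) → ℝ) : Prop :=
  ∀ x₁ x₂ g : ℝ, x₁ ≤ x₂ → (∀ x ∈ Set.Icc x₁ x₂, GappedAt Nf β x g L) →
    ∀ᶠ S in atTop, 0 < twistedZ Nf β x₁ S (a S) * twistedZ Nf β x₂ S (a S)

/-- **Programme statement T2 (the supercritical end value: `θ_u = π`, i.e. the sign FLIPS).** Deep
in the supercritical window (bare mass `x₁`, to be placed a fixed number of physical units below
the bulk real-mode-crossing band) the twisted partition function for the unit-charge background is
eventually NEGATIVE: free value `(−1)^{N_c · C₂} = (−1)^{3·1}` (Golterman–Jansen–Kaplan Chern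
numbers of the Wilson kernel; Adams' index theorem for admissible fields), to be transported to
the interacting measure at weak coupling. UNPROVED; the card's second debt. -/
def TwistSignFlipsDeep (Nf : ℕ) (β x₁ : ℝ) (a : ∀ S : ℕ, Edge 4 (2 * S + 1) → ℝ) : Prop :=
  ∀ᶠ S in atTop, twistedZ Nf β x₁ S (a S) < 0

/-- **What T1 + T2 + the heavy end buy: the non-gapped set below `1/10` is NONEMPTY at this
cutoff** — so `m_crit(k) := sup {x ≤ 1/10 : ¬ GappedAt …}` is a DEFINITION, at every `k`, with no
critical line ever computed (card `flavoured-theta-pi-index`, step L). -/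
def NonGappedBelow (Nf : ℕ) (β x₁ : ℝ) (L : ℕ) : Prop :=
  ∀ g : ℝ, ∃ x ∈ Set.Icc x₁ (1 / 10 : ℝ), ¬ GappedAt Nf β x g L

/-- **The index obstruction, assembled (PROVED from T1, T2 and Seiler positivity of the heavy
end).** If the twist sign is rigid on gapped intervals and flips at `x₁ < 1/10`, then some bare
mass in `[x₁, 1/10]` is not uniformly gapped at rate `g`, for every `g`. -/
theorem nonGappedBelow_of_index (Nf : ℕ) (β x₁ : ℝ) (hx₁ : x₁ ≤ 1 / 10) (L : ℕ)
    (a : ∀ S : ℕ, Edge 4 (2 * S + 1) → ℝ)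
    (hpos : ∀ᶠ S in atTop, 0 < twistedZ Nf β (1 / 10) S (a S))
    (T1 : TwistSignRigidOnGapped Nf β L a) (T2 : TwistSignFlipsDeep Nf β x₁ a) :
    NonGappedBelow Nf β x₁ L := by
  intro g
  by_contra hcon
  push Not at hcon
  have hgap : ∀ x ∈ Set.Icc x₁ (1 / 10 : ℝ), GappedAt Nf β x g L := fun x hx => hcon x hx
  have hrig := T1 x₁ (1 / 10) g hx₁ hgap
  obtain ⟨S, ⟨hprod, hneg⟩, hp⟩ := ((hrig.and T2).and hpos).exists
  have : twistedZ Nf β x₁ S (a S) * twistedZ Nf β (1 / 10) S (a S) < 0 := mul_neg_of_neg_of_pos hneg hp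
  linarith

end Summit.QuantumFields.QCD.Cruxes.ChiralMobilityGap.Ideator2
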